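import Summits.Ventures.HodgeRepro2.T5HermitianInertiaSpectral
import Summits.Ventures.HodgeRepro2.T5CartanDominant

/-!
# Sylvester's normal form SORTED: `diag(1^p, (−1)^q)` with the `+1`'s first (cell pub-hodge-repro2, seat p3)

Companion of T5HermitianInertia / T5HermitianInertiaSpectral. The existence half of Sylvester's law given there
(`exists_conjTranspose_mul_eq_diagonal_sign`) produces `Pᴴ M P = diag(sgn λᵢ)` in the ORDER of Mathlib's
eigenvalues; the cell's «signature (p, q)» carrier (t6-p4's `HasSig`, Liu 2021 p. 107 ll. 21–23) wants the normal
form `diag(1^p, (−1)^q)` = `pmVec n p`. Here, Mathlib-only: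

* `exists_perm_comp_eq_pmVec` — a `±1` vector on `Fin n` is `pmVec n p` (`p` = its number of `+1`'s) up to a
  permutation of `Fin n`;
* `permMatrix_conj_diagonal` — conjugating `diagonal d` by the permutation matrix of `τ⁻¹` (in the `Pᴴ · P` form)
  gives `diagonal (d ∘ τ)` — p8's `T5CartanDominant.permMatrix_mul_diagonal_mul_permMatrix_inv` read through
  Mathlib's `conjTranspose_permMatrix` (imported, not re-declared);
* `exists_conjTranspose_mul_eq_diagonal_pmVec_of_eq_diagonal` — any `±1` normal form can be re-sorted into
  `pmVec` form by a permutation of the basis (`P' := P * (τ⁻¹).permMatrix`);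
* `exists_conjTranspose_mul_eq_diagonal_pmVec` — **every invertible hermitian matrix has a signature
  `(p, q) = (#{λᵢ > 0}, #{λᵢ < 0})` in the `pmVec` (= `HasSig`) sense**, with `p + q = n`.

No display; no device. §8(d): uses an L-value-free non-vanishing device: NO.
-/

namespace Summit.Ventures.HodgeRepro2.T5HermitianInertiaSorted

open Matrix Finset T5HermitianInertia T5HermitianInertiaSpectral

variable {n : ℕ}

/-- A `±1` vector `d` on `Fin n` is `pmVec n p` with `p = #{i | d i = 1}` after a permutation `τ`:
`d ∘ τ = pmVec n p` (the indices with `d = 1` are moved to the front). -/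
theorem exists_perm_comp_eq_pmVec (d : Fin n → ℂ) (hd : ∀ i, d i = 1 ∨ d i = -1) :
    ∃ τ : Equiv.Perm (Fin n), d ∘ τ = pmVec n (Finset.univ.filter fun i => d i = 1).card := by
  classical
  set p := (Finset.univ.filter fun i => d i = 1).card with hp
  have hA : Fintype.card {i : Fin n // d i = 1} = p := by rw [Fintype.card_subtype]
  have hpn : p ≤ n := by
    have := Finset.card_filter_le (Finset.univ : Finset (Fin n)) (fun i => d i = 1)
    rwa [Finset.card_univ, Fintype.card_fin] at this
  have hB : Fintype.card {i : Fin n // ¬ d i = 1} = n - p := by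
    rw [Fintype.card_subtype_compl, Fintype.card_fin, hA]
  have hsum : p + (n - p) = n := Nat.add_sub_cancel' hpn
  let e₁ : Fin p ≃ {i : Fin n // d i = 1} := (Fintype.equivFinOfCardEq hA).symm
  let e₂ : Fin (n - p) ≃ {i : Fin n // ¬ d i = 1} := (Fintype.equivFinOfCardEq hB).symm
  let τ : Equiv.Perm (Fin n) :=
    ((finCongr hsum).symm.trans finSumFinEquiv.symm).trans
      ((e₁.sumCongr e₂).trans (Equiv.sumCompl fun i : Fin n => d i = 1))
  refine ⟨τ, funext fun i => ?_⟩
  simp only [Function.comp_apply, pmVec]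
  by_cases hi : (i : ℕ) < p
  · rw [if_pos hi]
    have h1 : (finCongr hsum).symm i = Fin.castAdd (n - p) ⟨i, hi⟩ := Fin.ext rfl
    show d (((finCongr hsum).symm.trans finSumFinEquiv.symm).trans
      ((e₁.sumCongr e₂).trans (Equiv.sumCompl fun i : Fin n => d i = 1)) i) = 1
    simp only [Equiv.trans_apply]
    rw [h1, finSumFinEquiv_symm_apply_castAdd, Equiv.sumCongr_apply, Sum.map_inl,
      Equiv.sumCompl_apply_inl]
    exact (e₁ ⟨i, hi⟩).2
  · rw [if_neg hi]
    have hi' : (i : ℕ) - p < n - p := by have := i.2; omega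
    have h2 : (finCongr hsum).symm i = Fin.natAdd p ⟨(i : ℕ) - p, hi'⟩ := by
      apply Fin.ext
      simp only [finCongr_symm, finCongr_apply_coe, Fin.natAdd_mk]
      omega
    show d (((finCongr hsum).symm.trans finSumFinEquiv.symm).trans
      ((e₁.sumCongr e₂).trans (Equiv.sumCompl fun i : Fin n => d i = 1)) i) = -1
    simp only [Equiv.trans_apply]
    rw [h2, finSumFinEquiv_symm_apply_natAdd, Equiv.sumCongr_apply, Sum.map_inr,
      Equiv.sumCompl_apply_inr]
    have hne := (e₂ ⟨(i : ℕ) - p, hi'⟩).2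
    rcases hd (e₂ ⟨(i : ℕ) - p, hi'⟩).1 with h | h
    · exact absurd h hne
    · exact h

/-- Conjugating `diagonal d` by the permutation matrix of `τ⁻¹` (in the `Pᴴ · P` form) permutes the diagonal:
`diagonal (d ∘ τ)` — p8's `T5CartanDominant.permMatrix_mul_diagonal_mul_permMatrix_inv` after
`(τ⁻¹.permMatrix)ᴴ = τ.permMatrix`. -/
theorem permMatrix_conj_diagonal (d : Fin n → ℂ) (τ : Equiv.Perm (Fin n)) :
    ((τ⁻¹).permMatrix ℂ)ᴴ * diagonal d * (τ⁻¹).permMatrix ℂ = diagonal (d ∘ τ) := by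
  rw [conjTranspose_permMatrix, inv_inv]
  exact T5CartanDominant.permMatrix_mul_diagonal_mul_permMatrix_inv τ d

/-- A permutation matrix is invertible. -/
theorem isUnit_det_permMatrix (τ : Equiv.Perm (Fin n)) : IsUnit ((τ.permMatrix ℂ).det) := by
  rw [det_permutation, isUnit_iff_ne_zero]
  exact Int.cast_ne_zero.2 (Units.ne_zero _)

/-- Any `±1` normal form `Pᴴ M P = diagonal d` can be re-sorted into the `pmVec` form
`diag(1^p, (−1)^{n−p})` with `p = #{i | d i = 1}`, by a permutation of the basis. -/
theorem exists_conjTranspose_mul_eq_diagonal_pmVec_of_eq_diagonal {M P : Matrix (Fin n) (Fin n) ℂ}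
    {d : Fin n → ℂ} (hP : IsUnit P.det) (hd : ∀ i, d i = 1 ∨ d i = -1)
    (hPM : Pᴴ * M * P = diagonal d) :
    ∃ P' : Matrix (Fin n) (Fin n) ℂ, IsUnit P'.det ∧
      P'ᴴ * M * P' = diagonal (pmVec n (Finset.univ.filter fun i => d i = 1).card) := by
  obtain ⟨τ, hτ⟩ := exists_perm_comp_eq_pmVec d hd
  refine ⟨P * (τ⁻¹).permMatrix ℂ, ?_, ?_⟩
  · rw [det_mul]
    exact hP.mul (isUnit_det_permMatrix _)
  · have key : ((τ⁻¹).permMatrix ℂ)ᴴ * Pᴴ * M * (P * (τ⁻¹).permMatrix ℂ) =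
        ((τ⁻¹).permMatrix ℂ)ᴴ * (Pᴴ * M * P) * (τ⁻¹).permMatrix ℂ := by
      simp only [Matrix.mul_assoc]
    rw [conjTranspose_mul, key, hPM, permMatrix_conj_diagonal, hτ]

/-- **Every invertible hermitian matrix has a signature in the `pmVec` (= `HasSig`) sense:**
`Pᴴ M P = diag(1^p, (−1)^q)` with `p` = the number of positive eigenvalues, `q` = the number of negative
ones, `p + q = n`. -/
theorem exists_conjTranspose_mul_eq_diagonal_pmVec {M : Matrix (Fin n) (Fin n) ℂ} (hM : M.IsHermitian)
    (hdet : IsUnit M.det) :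
    (Finset.univ.filter fun i => 0 < hM.eigenvalues i).card +
        (Finset.univ.filter fun i => hM.eigenvalues i < 0).card = n ∧
      ∃ P : Matrix (Fin n) (Fin n) ℂ, IsUnit P.det ∧
        Pᴴ * M * P = diagonal (pmVec n (Finset.univ.filter fun i => 0 < hM.eigenvalues i).card) := by
  obtain ⟨P, hP, hPM⟩ := exists_conjTranspose_mul_eq_diagonal_sign hM hdet
  have hsgn : ∀ i, sgn (hM.eigenvalues i) = 1 ∨ sgn (hM.eigenvalues i) = -1 := fun i => sgn_mem_pm _
  have hcount : (Finset.univ.filter fun i => sgn (hM.eigenvalues i) = 1).card =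
      (Finset.univ.filter fun i => 0 < hM.eigenvalues i).card := by
    congr 1
    ext i
    simp only [Finset.mem_filter, Finset.mem_univ, true_and, sgn_eq_one_iff]
  refine ⟨?_, ?_⟩
  · have h1 := card_one_eq_card_pos_eigenvalues hM hP hsgn hPM
    have h2 := card_neg_one_eq_card_neg_eigenvalues hM hP hsgn hPM
    have h3 := card_neg_one_add_card_one hsgn
    rw [Fintype.card_fin] at h3
    omega
  · rw [← hcount]
    exact exists_conjTranspose_mul_eq_diagonal_pmVec_of_eq_diagonal hP hsgn hPM

end Summit.Ventures.HodgeRepro2.T5HermitianInertiaSorted
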